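import Literature.Computability.Complexity.GraphCanonizationMachine
import HarnessLib

/-!
# The stack machine of the canoniser: the shape of every reachable configuration

Sequel of `GraphCanonizationMachine.lean` (`CGCanon.run_classify`: from `classify G W c :: stk` the
machine reaches `ret (canon R G W c) :: stk` in `steps R G W c` transitions). Here the SAME run is
followed configuration by configuration: at every intermediate time the configuration is
`top ++ stk` with

* `top.length ≤ depth W c + 1`, `depth W c = (k + 1)|W| - |c(W)|` (a rank of the termination
  measure of `canon`: a child state has strictly smaller depth), and
* every frame of `top` GOOD (`CGCanon.GoodF`): colours at most `k`, vertex lists of length at most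
  `k`, at most `k` parts, candidates of the form `(code G c ord, x, ord)` with `|ord| ≤ k`, `x < k`.

This is the invariant from which the string program gets its polynomial bound on the size of the
configurations (`GraphCanonizationProgramSize.lean`). The one hypothesis on the refinement operator
is a colour bound `R.refine G W c v ≤ k` (true for colour refinement, whose colours are ranks).

## References

* B. Laubner, PhD thesis, HU Berlin 2011, doi:10.18452/16335, §3.4. [Laubner2011]
* S. Arora, B. Barak, *Computational Complexity: A Modern Approach*, CUP 2009, §1.3. [AroraBarakCC2009]
-/

namespace Literature.Computability.Complexity

open Literature.Combinatorics.SimpleGraph Finset ColourRefinementScheme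

open scoped Classical

noncomputable section

namespace CGCanon

variable {k : ℕ} (R : Refiner k) (G : SimpleGraph (Fin k))

/-! ### Good frames and the depth of a state -/

/-- A good candidate: `(code G c ord, x, ord)` with `|ord| ≤ k` and `x < k`. [folklore] -/
def GoodCand (c : Fin k → ℕ) (b : Cand k) : Prop :=
  (ofLex (ofLex b).2).2.length ≤ k ∧ (ofLex (ofLex b).2).1 < k ∧ (ofLex b).1 = code G c (ofLex (ofLex b).2).2

/-- **Good frames**: the size-relevant shape of the frames the machine creates. [folklore] -/
def GoodF : Frame k → Prop
  | Frame.indiv _ c _ xs best => (∀ v, c v ≤ k) ∧ xs.length ≤ k ∧ ∀ b ∈ best, GoodCand G c b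
  | Frame.sect _ c _ todo done => (∀ v, c v ≤ k) ∧ todo.length + done.length ≤ k ∧ ∀ p ∈ done, p.2.length ≤ k
  | Frame.ret ord => ord.length ≤ k

/-- **The depth of a state**: `(k + 1)|W| - |c(W)|`. [folklore] -/
def depth (W : Finset (Fin k)) (c : Fin k → ℕ) : ℕ := (k + 1) * W.card - (W.image c).card

variable {R G}

/-- A vertex subset has at most `k` vertices. [folklore] -/
theorem card_le_k (W : Finset (Fin k)) : W.card ≤ k := (card_le_univ W).trans (by rw [Fintype.card_fin])

/-- The child of an individualization node is strictly shallower. [folklore] -/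
theorem depth_lt_of_mem_bigMinCell (W : Finset (Fin k)) (c : Fin k → ℕ) {x : Fin k} (hx : x ∈ bigMinCell W c) :
    depth W (R.refine G W (individualize c x)) + 1 ≤ depth W c := by
  have h := measure_lt_of_mem_bigMinCell R G W c hx
  have h1 : (W.image c).card ≤ W.card := card_image_le
  have h2 : (W.image (R.refine G W (individualize c x))).card ≤ W.card := card_image_le
  unfold depth
  have h3 : W.card ≤ (k + 1) * W.card := Nat.le_mul_of_pos_left _ (Nat.succ_pos k)
  omega

/-- A part of a section node is strictly shallower. [folklore] -/
theorem depth_lt_of_card_lt {W K : Finset (Fin k)} (c : Fin k → ℕ) (hK : K.card < W.card) : depth K c + 1 ≤ depth W c := by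
  have h1 : (W.image c).card ≤ W.card := card_image_le
  have hW := card_le_k W
  unfold depth
  have h3 : (k + 1) * K.card + (k + 1) ≤ (k + 1) * W.card := by rw [← Nat.mul_succ]; exact Nat.mul_le_mul_left _ hK
  omega

/-- The canonical ordering of a state is short. [folklore] -/
theorem length_canon_le (W : Finset (Fin k)) (c : Fin k → ℕ) : (canon R G W c).length ≤ k := by
  rw [(nodup_canon R G W c).2]; exact card_le_k W

/-- The candidate of a branching vertex is good. [folklore] -/
theorem goodCand_cand (W : Finset (Fin k)) (c : Fin k → ℕ) (x : Fin k) : GoodCand G c (cand R G W c x) :=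
  ⟨length_canon_le W _, x.isLt, rfl⟩

/-- Keeping the least candidate keeps goodness. [folklore] -/
theorem goodCand_bestOf {c : Fin k → ℕ} {o : Option (Cand k)} (ho : ∀ b ∈ o, GoodCand G c b) {b : Cand k} (hb : GoodCand G c b) :
    ∀ b' ∈ bestOf o b, GoodCand G c b' := by
  intro b' hb'
  cases o with
  | none => simp [bestOf] at hb'; subst hb'; exact hb
  | some a =>
    simp [bestOf] at hb'
    subst hb'
    rcases min_choice a b with h | h <;> rw [h]
    · exact ho a rfl
    · exact hb

/-- The parts enumeration is short. [folklore] -/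
theorem length_partsList_le (W : Finset (Fin k)) (c : Fin k → ℕ) : (partsList G W c).length ≤ k := by
  unfold partsList
  exact ((List.dedup_sublist _).length_le.trans (by rw [List.length_map, length_sort])).trans (card_le_k W)

/-- The starting frame of a state is good. [folklore] -/
theorem goodF_classify {W : Finset (Fin k)} {c : Fin k → ℕ} (hc : ∀ v, c v ≤ k) : GoodF G (classify G W c) := by
  unfold classify
  split_ifs with h1 h2 h3
  · show (W.sort (· ≤ ·)).length ≤ k
    rw [length_sort]; exact card_le_k W
  · exact ⟨hc, by rw [length_sort]; exact card_le_k _, fun b hb => by simp at hb⟩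
  · show (W.sort (· ≤ ·)).length ≤ k
    rw [length_sort]; exact card_le_k W
  · exact ⟨hc, by rw [List.length_nil, Nat.add_zero]; exact length_partsList_le W c, fun p hp => by simp at hp⟩

/-! ### The phases of a node -/

/-- **Individualization phase**: processing the branching vertices `xs` one by one keeps the
configuration `top ++ stk` with `top` short and good. [cite: Laubner2011, §3.4] -/
theorem run_indiv_good {W : Finset (Fin k)} {c : Fin k → ℕ} (hc : ∀ v, c v ≤ k)
    (IH : ∀ x ∈ bigMinCell W c, ∀ (stk' : List (Frame k)) (m' : ℕ), m' ≤ steps R G W (R.refine G W (individualize c x)) →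
      ∃ top, run R G m' (classify G W (R.refine G W (individualize c x)) :: stk') = top ++ stk' ∧
        top.length ≤ depth W (R.refine G W (individualize c x)) + 1 ∧ ∀ f ∈ top, GoodF G f)
    (xs : List (Fin k)) (hxs : ∀ x ∈ xs, x ∈ bigMinCell W c) (hlen : xs.length ≤ k) (cur : Option (Fin k)) (best : Option (Cand k))
    (hbest : ∀ b ∈ best, GoodCand G c b) (stk : List (Frame k)) {m : ℕ}
    (hm : m ≤ (xs.map fun x => steps R G W (R.refine G W (individualize c x)) + 2).sum) :
    ∃ top, run R G m (Frame.indiv W c cur xs best :: stk) = top ++ stk ∧ top.length ≤ depth W c + 1 ∧ ∀ f ∈ top, GoodF G f := by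
  induction xs generalizing cur best m with
  | nil =>
    simp only [List.map_nil, List.sum_nil, Nat.le_zero] at hm
    subst hm
    exact ⟨[Frame.indiv W c cur [] best], rfl, by simp, fun f hf => by simp at hf; subst hf; exact ⟨hc, Nat.zero_le _, hbest⟩⟩
  | cons x xs ih =>
    have hx : x ∈ bigMinCell W c := hxs x List.mem_cons_self
    set s := steps R G W (R.refine G W (individualize c x)) with hs
    rw [List.map_cons, List.sum_cons] at hm
    rcases Nat.eq_zero_or_pos m with rfl | hm0
    · exact ⟨[Frame.indiv W c cur (x :: xs) best], rfl, by simp, fun f hf => by simp at hf; subst hf; exact ⟨hc, hlen, hbest⟩⟩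
    have h1 : run R G 1 (Frame.indiv W c cur (x :: xs) best :: stk) =
        classify G W (R.refine G W (individualize c x)) :: Frame.indiv W c (some x) xs best :: stk := by
      rw [run_succ]; cases cur <;> rfl
    have hgood : GoodF G (Frame.indiv W c (some x) xs best) := ⟨hc, (Nat.le_succ _).trans hlen, hbest⟩
    by_cases hm1 : m ≤ s + 1
    · -- inside the child of `x`
      obtain ⟨m', rfl⟩ : ∃ m', m = 1 + m' := ⟨m - 1, by omega⟩
      obtain ⟨top, htop, hlen', hgood'⟩ := IH x hx (Frame.indiv W c (some x) xs best :: stk) m' (by omega)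
      refine ⟨top ++ [Frame.indiv W c (some x) xs best], ?_, ?_, ?_⟩
      · rw [run_add, h1, htop, List.append_assoc]; rfl
      · rw [List.length_append, List.length_singleton]
        have := depth_lt_of_mem_bigMinCell (R := R) (G := G) W c hx
        omega
      · intro f hf
        rcases List.mem_append.1 hf with hf | hf
        · exact hgood' f hf
        · rw [List.mem_singleton.1 hf]; exact hgood
    · -- after the child of `x`
      obtain ⟨m', rfl⟩ : ∃ m', m = (1 + s + 1) + m' := ⟨m - (s + 2), by omega⟩
      have hphase : run R G (1 + s + 1) (Frame.indiv W c cur (x :: xs) best :: stk) =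
          Frame.indiv W c none xs (bestOf best (cand R G W c x)) :: stk := by
        rw [run_add, run_add, h1, hs, run_classify, run_succ]; rfl
      rw [run_add, hphase]
      exact ih (fun y hy => hxs y (List.mem_cons_of_mem _ hy)) ((Nat.le_succ _).trans hlen) none _
        (goodCand_bestOf hbest (goodCand_cand W c x)) (by omega)

/-- **Section phase**: processing the parts `todo` one by one keeps the configuration `top ++ stk`
with `top` short and good. [cite: Laubner2011, §3.4] -/
theorem run_sect_good {W : Finset (Fin k)} {c : Fin k → ℕ} (hc : ∀ v, c v ≤ k) (hconn : ¬ IsConn G W c)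
    (IH : ∀ K ∈ parts G W c, ∀ (stk' : List (Frame k)) (m' : ℕ), m' ≤ steps R G K c →
      ∃ top, run R G m' (classify G K c :: stk') = top ++ stk' ∧ top.length ≤ depth K c + 1 ∧ ∀ f ∈ top, GoodF G f)
    (todo : List (Finset (Fin k))) (htodo : ∀ K ∈ todo, K ∈ parts G W c) (cur : Option (Finset (Fin k)))
    (done : List (Finset (Fin k) × List (Fin k))) (hlen : todo.length + done.length ≤ k) (hdone : ∀ p ∈ done, p.2.length ≤ k)
    (stk : List (Frame k)) {m : ℕ} (hm : m ≤ (todo.map fun K => steps R G K c + 2).sum) :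
    ∃ top, run R G m (Frame.sect W c cur todo done :: stk) = top ++ stk ∧ top.length ≤ depth W c + 1 ∧ ∀ f ∈ top, GoodF G f := by
  induction todo generalizing cur done m with
  | nil =>
    simp only [List.map_nil, List.sum_nil, Nat.le_zero] at hm
    subst hm
    exact ⟨[Frame.sect W c cur [] done], rfl, by simp, fun f hf => by simp at hf; subst hf; exact ⟨hc, hlen, hdone⟩⟩
  | cons K todo ih =>
    have hK : K ∈ parts G W c := htodo K List.mem_cons_self
    set s := steps R G K c with hs
    rw [List.map_cons, List.sum_cons] at hm
    rcases Nat.eq_zero_or_pos m with rfl | hm0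
    · exact ⟨[Frame.sect W c cur (K :: todo) done], rfl, by simp, fun f hf => by simp at hf; subst hf; exact ⟨hc, hlen, hdone⟩⟩
    have h1 : run R G 1 (Frame.sect W c cur (K :: todo) done :: stk) = classify G K c :: Frame.sect W c (some K) todo done :: stk := by
      rw [run_succ]; cases cur <;> rfl
    have hlen1 : todo.length + done.length ≤ k := by rw [List.length_cons] at hlen; omega
    have hgood : GoodF G (Frame.sect W c (some K) todo done) := ⟨hc, hlen1, hdone⟩
    by_cases hm1 : m ≤ s + 1
    · obtain ⟨m', rfl⟩ : ∃ m', m = 1 + m' := ⟨m - 1, by omega⟩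
      obtain ⟨top, htop, hlen', hgood'⟩ := IH K hK (Frame.sect W c (some K) todo done :: stk) m' (by omega)
      refine ⟨top ++ [Frame.sect W c (some K) todo done], ?_, ?_, ?_⟩
      · rw [run_add, h1, htop, List.append_assoc]; rfl
      · rw [List.length_append, List.length_singleton]
        have := depth_lt_of_card_lt (k := k) c (card_lt_of_mem_parts hconn hK)
        omega
      · intro f hf
        rcases List.mem_append.1 hf with hf | hf
        · exact hgood' f hf
        · rw [List.mem_singleton.1 hf]; exact hgood
    · obtain ⟨m', rfl⟩ : ∃ m', m = (1 + s + 1) + m' := ⟨m - (s + 2), by omega⟩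
      have hphase : run R G (1 + s + 1) (Frame.sect W c cur (K :: todo) done :: stk) =
          Frame.sect W c none todo (done ++ [(K, canon R G K c)]) :: stk := by
        rw [run_add, run_add, h1, hs, run_classify, run_succ]; rfl
      rw [run_add, hphase]
      refine ih (fun K' hK' => htodo K' (List.mem_cons_of_mem _ hK')) none _ ?_ ?_ (by omega)
      · rw [List.length_append, List.length_singleton]; rw [List.length_cons] at hlen; omega
      · intro p hp
        rcases List.mem_append.1 hp with hp | hp
        · exact hdone p hp
        · rw [List.mem_singleton.1 hp]; exact length_canon_le K c

/-! ### The invariant -/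

/-- **Every configuration of the run of a state is short and good**: with a refinement operator
whose colours are at most `k`, from `classify G W c :: stk` (colours of `c` at most `k`), at every
time `m ≤ steps R G W c` the configuration is `top ++ stk` with `|top| ≤ depth W c + 1` and every
frame of `top` good. [cite: Laubner2011, §3.4] -/
theorem run_classify_good (hR : ∀ (W : Finset (Fin k)) (c : Fin k → ℕ) (v : Fin k), R.refine G W c v ≤ k)
    (W : Finset (Fin k)) (c : Fin k → ℕ) (hc : ∀ v, c v ≤ k) (stk : List (Frame k)) {m : ℕ} (hm : m ≤ steps R G W c) :
    ∃ top, run R G m (classify G W c :: stk) = top ++ stk ∧ top.length ≤ depth W c + 1 ∧ ∀ f ∈ top, GoodF G f := by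
  suffices H : ∀ (n m' : ℕ) (W : Finset (Fin k)) (c : Fin k → ℕ), W.card = n → W.card - (W.image c).card = m' → (∀ v, c v ≤ k) →
      ∀ (stk : List (Frame k)) (m : ℕ), m ≤ steps R G W c →
        ∃ top, run R G m (classify G W c :: stk) = top ++ stk ∧ top.length ≤ depth W c + 1 ∧ ∀ f ∈ top, GoodF G f from
    H _ _ W c rfl rfl hc stk m hm
  intro n
  induction n using Nat.strong_induction_on with
  | _ n ihn =>
  intro m'
  induction m' using Nat.strong_induction_on with
  | _ m' ihm =>
  intro W c hn hm' hc stk m hm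
  have h0 : ∀ {m : ℕ}, m = 0 → ∃ top, run R G m (classify G W c :: stk) = top ++ stk ∧ top.length ≤ depth W c + 1 ∧ ∀ f ∈ top, GoodF G f :=
    fun hm => ⟨[classify G W c], by subst hm; rfl, by simp, fun f hf => by simp at hf; subst hf; exact goodF_classify hc⟩
  have hfin : m = steps R G W c → ∃ top, run R G m (classify G W c :: stk) = top ++ stk ∧ top.length ≤ depth W c + 1 ∧ ∀ f ∈ top, GoodF G f :=
    fun hm => ⟨[Frame.ret (canon R G W c)], by rw [hm, run_classify]; rfl, by simp, fun f hf => by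
      simp at hf; subst hf; exact length_canon_le W c⟩
  by_cases hW : W.card ≤ 1
  · exact h0 (by rw [steps_of_card_le_one hW] at hm; omega)
  by_cases hconn : IsConn G W c
  · by_cases hA : (bigMinCell W c).Nonempty
    · rw [steps_of_isConn hW hconn hA] at hm
      rcases hm.lt_or_eq with hm | hm
      · have hm'' : m ≤ (((bigMinCell W c).sort (· ≤ ·)).map fun x => steps R G W (R.refine G W (individualize c x)) + 2).sum := by
          rw [sum_map_eq_sum_attach (sort_perm_toList (s := bigMinCell W c) (r := (· ≤ ·)))]; omega
        have hcl : classify G W c = Frame.indiv W c none ((bigMinCell W c).sort (· ≤ ·)) none := by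
          rw [classify, if_neg hW, if_pos hconn, if_pos hA]
        rw [hcl]
        exact run_indiv_good hc (fun x hx stk' m'' hle => ihm _ (hm' ▸ measure_lt_of_mem_bigMinCell R G W c hx) W _ hn rfl (hR W _) stk' m'' hle)
          _ (fun x hx => by simpa using hx) (by rw [length_sort]; exact card_le_k _) none none (fun b hb => by simp at hb) stk hm''
      · exact hfin (by rw [steps_of_isConn hW hconn hA, hm])
    · exact h0 (by rw [steps_of_isConn_of_not_nonempty hW hconn hA] at hm; omega)
  · rw [steps_of_not_isConn hW hconn] at hm
    rcases hm.lt_or_eq with hm | hm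
    · have hm'' : m ≤ ((partsList G W c).map fun K => steps R G K c + 2).sum := by
        rw [sum_map_eq_sum_attach (partsList_perm_toList (G := G) W c)]; omega
      have hcl : classify G W c = Frame.sect W c none (partsList G W c) [] := by
        rw [classify, if_neg hW, if_neg hconn]
      rw [hcl]
      exact run_sect_good hc hconn (fun K hK stk' m'' hle => ihn K.card (hn ▸ card_lt_of_mem_parts hconn hK) _ K c rfl rfl hc stk' m'' hle)
        _ (fun K hK => mem_toList.1 ((partsList_perm_toList W c).mem_iff.1 hK)) none [] (by simpa using length_partsList_le (G := G) W c)
        (fun p hp => by simp at hp) stk hm''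
    · exact hfin (by rw [steps_of_not_isConn hW hconn, hm])

/-- **Hence every configuration of the whole run from a lone starting frame is short and good**,
at every time (after `steps` transitions it is the fixed point `[ret (canon R G W c)]`). [cite: Laubner2011, §3.4] -/
theorem run_good (hR : ∀ (W : Finset (Fin k)) (c : Fin k → ℕ) (v : Fin k), R.refine G W c v ≤ k)
    (W : Finset (Fin k)) (c : Fin k → ℕ) (hc : ∀ v, c v ≤ k) (m : ℕ) :
    (run R G m [classify G W c]).length ≤ depth W c + 1 ∧ ∀ f ∈ run R G m [classify G W c], GoodF G f := by
  rcases le_or_gt m (steps R G W c) with hm | hm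
  · obtain ⟨top, htop, hlen, hgood⟩ := run_classify_good hR W c hc [] hm
    rw [List.append_nil] at htop
    rw [htop]; exact ⟨hlen, hgood⟩
  · obtain ⟨d, rfl⟩ := Nat.exists_eq_add_of_lt hm
    rw [Nat.add_assoc, run_add, run_classify, run_halt]
    exact ⟨by simp, fun f hf => by simp at hf; subst hf; exact length_canon_le W c⟩

/-- The depth of any state is at most `(k + 1) k`. [folklore] -/
theorem depth_le (W : Finset (Fin k)) (c : Fin k → ℕ) : depth W c ≤ (k + 1) * k :=
  (Nat.sub_le _ _).trans (Nat.mul_le_mul_left _ (card_le_k W))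

end CGCanon

end

end Literature.Computability.Complexity
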